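import Summits.ResolutionOfSingularities.ResolutionOfSingularities.Theorems.FrobeniusLadderFInjectiveMacaulayficationBlowupFiModel
import Summits.ResolutionOfSingularities.ResolutionOfSingularities.Theorems.FrobeniusLadderFInjectiveMacaulayficationStrictTransformChart
import Summits.ResolutionOfSingularities.ResolutionOfSingularities.Theorems.FrobeniusLadderFInjectiveMacaulayficationE8Forms
import Summits.ResolutionOfSingularities.ResolutionOfSingularities.Theorems.FrobeniusLadderFInjectiveMacaulayficationE8ChartZUnit
import Summits.ResolutionOfSingularities.ResolutionOfSingularities.Theorems.FrobeniusLadderFInjectiveMacaulayficationE8OffCentreRegular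
import Summits.ResolutionOfSingularities.ResolutionOfSingularities.Theorems.FrobeniusLadderFInjectiveMacaulayficationE8ChartYPoints
import Summits.ResolutionOfSingularities.ResolutionOfSingularities.Theorems.FrobeniusLadderFInjectiveMacaulayficationE8ChartXPoints
import HarnessLib

/-!
# Calibration: the point blow-up F-injectivizes `E₈⁰` in characteristic 5 (crux `FInjectiveMacaulayfication`)

Support file for crux stmt-ResolutionOfSingularities-15315 (`FrobeniusLadder.FInjectiveMacaulayfication`,
line `Sketch`, lead seat c4, cycle 5): the lead's assembly stub `stub_e8Char5FiModel` of the §7 CALIBRATION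
package. For every field `k` of characteristic `5`, the affine surface
`X₁ = Spec k[X₀,X₁,X₂]/(X₂² + X₀³ + X₁⁵)` (the rational double point `E₈⁰`: normal, Cohen–Macaulay, NOT
F-injective at the origin — `FedderOrigin.e8_origin_not_clause_char5` — and such that NO blow-up of a parameter
ideal yields the crux's model, `OneParameterIdeal.parameterCentre_noGo_of_not_fInjective`) admits the model the
crux asks for: a proper birational `π : X' → X₁` all of whose stalks are domains in which every system of
parameters is weakly regular and generates a Frobenius closed ideal. The model is the blow-up of the origin,
`X' = Bl_𝔪 X₁ = affineBlowup 𝔪` — a SINGULAR surface (it carries an `E₇` point): F-injectivization without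
resolution, by a non-parameter centre. This is the first certified instance of the conclusion of the open core
`stub_fInjectivize` at a non-F-injective input.

Assembly (`e8Char5FiModel`, registered form `stub_e8Char5FiModel`) of the blow-up glue E6′
(`BlowupFiModel.blowupFiModel_of_maximal`) with the wave-2/3 stubs of the cycle:
* off the origin `X₁` is regular (`E8OffCentreRegular.stub_e8OffCentreRegular`, Jacobian) hence satisfies the
  clause (`FiClauseOfRegular.stub_fiClauseOfRegular`);
* the `x`- and `y`-charts of the blow-up are the hypersurfaces `k[X]/(gₓ)`, `k[X]/(g_y)` by the strict-transform
  presentation (`StrictTransformChart.stub_strictTransformChart` with the identities and primality facts of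
  `E8Forms.stub_e8Forms`), where the clause holds at every closed point of the exceptional divisor
  (`E8ChartXPoints.stub_e8ChartXPoints`: all regular; `E8ChartYPoints.stub_e8ChartYPoints`: regular except the
  `E₇` point, which passes Fedder's test in characteristic 5) — transported to the chart rings along the induced
  isomorphisms of local rings (`nonempty_ringEquiv_localization_comap`, `clause_maximal_of_ringEquiv`,
  `chart_clause_of_presentation`); the input itself fails the clause at the origin (`e8Char5_origin_not_clause`);
* the `z`-chart does not meet the exceptional divisor (`E8ChartZUnit.stub_e8ChartZUnit`: `z̄/1` is a unit).

References: M. Artin, "Coverings of the rational double points in characteristic p" (1977) for the normal forms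
`E₈⁰`, `E₇⁰`; R. Fedder, Trans. AMS 278 (1983), Prop. 1.7, Thm. 1.12. [folklore]
-/

-- single-problem summit: the doubled namespace component is forced
set_option linter.dupNamespace false

noncomputable section

namespace Summit.ResolutionOfSingularities.ResolutionOfSingularities.Theorems.FInjectiveMacaulayfication.E8Char5FiModel

open AlgebraicGeometry CategoryTheory Literature.AlgebraicGeometry.Resolution
open Summit.ResolutionOfSingularities.ResolutionOfSingularities.Theorems.FInjectiveMacaulayfication

/-- A ring isomorphism `e : B ≃+* A` induces `B_{e⁻¹Q} ≅ A_Q` for every prime `Q` of `A`. [folklore] -/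
theorem nonempty_ringEquiv_localization_comap {A B : Type*} [CommRing A] [CommRing B] (e : B ≃+* A)
    (Q : Ideal A) [Q.IsPrime] :
    Nonempty (Localization.AtPrime (Q.comap e.toRingHom) ≃+* Localization.AtPrime Q) := by
  refine ⟨IsLocalization.ringEquivOfRingEquiv (M := (Q.comap e.toRingHom).primeCompl) (T := Q.primeCompl)
    (Localization.AtPrime (Q.comap e.toRingHom)) (Localization.AtPrime Q) e ?_⟩
  ext y
  simp only [Submonoid.mem_map]
  constructor
  · rintro ⟨b, hb, rfl⟩
    intro hy
    exact hb (Ideal.mem_comap.mpr hy)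
  · intro hy
    refine ⟨e.symm y, fun h => hy ?_, e.apply_symm_apply y⟩
    have h' := Ideal.mem_comap.mp h
    rwa [RingEquiv.toRingHom_eq_coe, RingEquiv.coe_toRingHom, e.apply_symm_apply] at h'

/-- Transport of "the Cohen–Macaulay + Frobenius-closed clause at every maximal ideal containing a marked
element" along a ring isomorphism `e : B ≃+* A` with `e b = a` (from `B`, marked by `b`, to `A`, marked by
`a`). [folklore] -/
theorem clause_maximal_of_ringEquiv (p : ℕ) {A B : Type} [CommRing A] [CommRing B] (e : B ≃+* A) (b : B)
    (a : A) (hba : e b = a)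
    (h : ∀ (Q : Ideal B) [Q.IsMaximal], b ∈ Q →
      ∀ d : ℕ, ringKrullDim (Localization.AtPrime Q) = d → ∀ s : Fin d → Localization.AtPrime Q,
        (Ideal.span (Set.range s)).radical.IsMaximal →
          RingTheory.Sequence.IsWeaklyRegular (Localization.AtPrime Q) (List.ofFn s) ∧
          ∀ y : Localization.AtPrime Q, (∃ n : ℕ, y ^ p ^ n ∈ Ideal.span
            ((fun z : Localization.AtPrime Q => z ^ p ^ n) ''
              (Ideal.span (Set.range s) : Set (Localization.AtPrime Q)))) → y ∈ Ideal.span (Set.range s))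
    (Q : Ideal A) [hQ : Q.IsMaximal] (haQ : a ∈ Q) :
    ∀ d : ℕ, ringKrullDim (Localization.AtPrime Q) = d → ∀ s : Fin d → Localization.AtPrime Q,
      (Ideal.span (Set.range s)).radical.IsMaximal →
        RingTheory.Sequence.IsWeaklyRegular (Localization.AtPrime Q) (List.ofFn s) ∧
        ∀ y : Localization.AtPrime Q, (∃ n : ℕ, y ^ p ^ n ∈ Ideal.span
          ((fun z : Localization.AtPrime Q => z ^ p ^ n) ''
            (Ideal.span (Set.range s) : Set (Localization.AtPrime Q)))) → y ∈ Ideal.span (Set.range s) := by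
  haveI : (Q.comap e.toRingHom).IsMaximal := Ideal.comap_isMaximal_of_surjective _ e.surjective
  have hb : b ∈ Q.comap e.toRingHom := by
    rw [Ideal.mem_comap, RingEquiv.toRingHom_eq_coe, RingEquiv.coe_toRingHom, hba]
    exact haQ
  obtain ⟨eloc⟩ := nonempty_ringEquiv_localization_comap e Q
  exact DegreeZeroDescent.inlineClause_of_ringEquiv p eloc (h (Q.comap e.toRingHom) hb)

-- budget: the chart-ring types make every unification step on this statement expensive (≈ 3× default)
set_option maxHeartbeats 800000 in
/-- The chart dictionary of the calibration, for a VARIABLE chart index `i`: a strict-transform presentation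
`k[X]/(g) ≅ A_i = (R[𝔪t])_{(x̄ᵢt)}` (`StrictTransformChart.stub_strictTransformChart`) carries "the clause at the
maximal ideals of `k[X]/(g)` containing `X̄ᵢ`" to "the clause at the maximal ideals of `A_i` containing `x̄ᵢ/1`"
(`clause_maximal_of_ringEquiv`). [folklore] -/
theorem chart_clause_of_presentation (k : Type) [Field k] (f : MvPolynomial (Fin 3) k)
    (hfprime : (Ideal.span {f}).IsPrime) (hf0 : f ≠ 0)
    (x : Fin 3 → MvPolynomial (Fin 3) k ⧸ Ideal.span {f})
    (hx : x = fun j : Fin 3 => Ideal.Quotient.mk (Ideal.span {f}) (MvPolynomial.X j))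
    (i : Fin 3) (g : MvPolynomial (Fin 3) k) (μ : ℕ) (hg : (Ideal.span {g}).IsPrime)
    (hXg : MvPolynomial.X i ∉ Ideal.span {g})
    (hθ : MvPolynomial.aeval (fun j : Fin 3 => if j = i then (MvPolynomial.X i : MvPolynomial (Fin 3) k)
        else MvPolynomial.X j * MvPolynomial.X i) f = MvPolynomial.X i ^ μ * g)
    (hpts : ∀ (Q' : Ideal (MvPolynomial (Fin 3) k ⧸ Ideal.span {g})) [Q'.IsMaximal],
        Ideal.Quotient.mk (Ideal.span {g}) (MvPolynomial.X i) ∈ Q' →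
        ∀ d : ℕ, ringKrullDim (Localization.AtPrime Q') = d → ∀ s : Fin d → Localization.AtPrime Q',
          (Ideal.span (Set.range s)).radical.IsMaximal →
            RingTheory.Sequence.IsWeaklyRegular (Localization.AtPrime Q') (List.ofFn s) ∧
            ∀ y : Localization.AtPrime Q', (∃ e : ℕ, y ^ 5 ^ e ∈ Ideal.span
              ((fun z : Localization.AtPrime Q' => z ^ 5 ^ e) ''
                (Ideal.span (Set.range s) : Set (Localization.AtPrime Q')))) → y ∈ Ideal.span (Set.range s))
    (Q : Ideal (HomogeneousLocalization.Away (reesGrading (Ideal.span (Set.range x)))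
          (reesT (x i) (Ideal.subset_span (Set.mem_range_self i))))) [Q.IsMaximal]
    (huQ : reesChartBase (x i) (Ideal.subset_span (Set.mem_range_self i)) (x i) ∈ Q) :
    ∀ d : ℕ, ringKrullDim (Localization.AtPrime Q) = d → ∀ s : Fin d → Localization.AtPrime Q,
      (Ideal.span (Set.range s)).radical.IsMaximal →
        RingTheory.Sequence.IsWeaklyRegular (Localization.AtPrime Q) (List.ofFn s) ∧
        ∀ y : Localization.AtPrime Q, (∃ e : ℕ, y ^ 5 ^ e ∈ Ideal.span
          ((fun z : Localization.AtPrime Q => z ^ 5 ^ e) ''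
            (Ideal.span (Set.range s) : Set (Localization.AtPrime Q)))) → y ∈ Ideal.span (Set.range s) := by
  obtain ⟨e, he⟩ := StrictTransformChart.stub_strictTransformChart k f g i μ hfprime hf0 hg hXg hθ x hx
  -- (elaborate the transported clause WITHOUT the goal as expected type, then close by `exact`: the other
  -- order makes the unifier compare instance paths on the chart ring and times out)
  have key := clause_maximal_of_ringEquiv 5 e _ _ he (fun Q' _ hQ' => hpts Q' hQ') Q huQ
  exact key

/-- Off the origin `E₈⁰` (characteristic `5`) is regular, hence its local rings satisfy the full stalk clause
(`E8OffCentreRegular.stub_e8OffCentreRegular`, `FiClauseOfRegular.stub_fiClauseOfRegular`). [folklore] -/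
theorem offCentre_fiClause (k : Type) [Field k] [CharP k 5] (f : MvPolynomial (Fin 3) k)
    (hf : f = MvPolynomial.X 2 ^ 2 + MvPolynomial.X 0 ^ 3 + MvPolynomial.X 1 ^ 5)
    (P : Ideal (MvPolynomial (Fin 3) k ⧸ Ideal.span {f})) [P.IsPrime]
    (hP : ¬ Ideal.span (Set.range fun j : Fin 3 => Ideal.Quotient.mk (Ideal.span {f}) (MvPolynomial.X j)) ≤ P) :
    IsDomain (Localization.AtPrime P) ∧
      ∀ d : ℕ, ringKrullDim (Localization.AtPrime P) = d → ∀ s : Fin d → Localization.AtPrime P,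
        (Ideal.span (Set.range s)).radical.IsMaximal →
          RingTheory.Sequence.IsWeaklyRegular (Localization.AtPrime P) (List.ofFn s) ∧
          ∀ y : Localization.AtPrime P, (∃ e : ℕ, y ^ 5 ^ e ∈ Ideal.span
            ((fun z : Localization.AtPrime P => z ^ 5 ^ e) ''
              (Ideal.span (Set.range s) : Set (Localization.AtPrime P)))) → y ∈ Ideal.span (Set.range s) := by
  haveI : Fact (Nat.Prime 5) := ⟨Nat.prime_five⟩
  haveI : IsRegularLocalRing (Localization.AtPrime P) := E8OffCentreRegular.stub_e8OffCentreRegular k f hf P hP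
  haveI : CharP (Localization.AtPrime P) 5 := E8ChartXPoints.charP_localization_atPrime_quotient k f P
  exact FiClauseOfRegular.stub_fiClauseOfRegular 5 (Localization.AtPrime P)

/-- **The point blow-up F-injectivizes `E₈⁰` in characteristic 5** (assembly of the §7 calibration; see the
module docstring): for every field `k` of characteristic `5` and `f = X₂² + X₀³ + X₁⁵`, the blow-up of
`Spec k[X]/(f)` at the origin is a proper birational model all of whose stalks are domains with every system of
parameters weakly regular and every parameter ideal Frobenius closed. [folklore] -/
theorem e8Char5FiModel (k : Type) [Field k] [CharP k 5] (f : MvPolynomial (Fin 3) k)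
    (hf : f = MvPolynomial.X 2 ^ 2 + MvPolynomial.X 0 ^ 3 + MvPolynomial.X 1 ^ 5) :
    ∃ (X' : Scheme.{0}) (π : X' ⟶ Spec (.of (MvPolynomial (Fin 3) k ⧸ Ideal.span {f}))), IsProper π ∧
      Literature.AlgebraicGeometry.Resolution.IsBirational π ∧
      ∀ y : X', IsDomain (X'.presheaf.stalk y) ∧ ∀ d : ℕ, ringKrullDim (X'.presheaf.stalk y) = d →
        ∀ s : Fin d → X'.presheaf.stalk y, (Ideal.span (Set.range s)).radical.IsMaximal →
          RingTheory.Sequence.IsWeaklyRegular (X'.presheaf.stalk y) (List.ofFn s) ∧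
          ∀ z : X'.presheaf.stalk y, (∃ e : ℕ, z ^ 5 ^ e ∈
              Ideal.span ((fun w : X'.presheaf.stalk y => w ^ 5 ^ e) ''
                (Ideal.span (Set.range s) : Set (X'.presheaf.stalk y)))) →
            z ∈ Ideal.span (Set.range s) := by
  haveI : Fact (Nat.Prime 5) := ⟨Nat.prime_five⟩
  -- the forms: `f` prime, the strict transforms `gx`, `gy` prime, the chart identities
  obtain ⟨gx, hgx⟩ : ∃ gx : MvPolynomial (Fin 3) k,
      gx = MvPolynomial.X 2 ^ 2 + MvPolynomial.X 0 + MvPolynomial.X 0 ^ 3 * MvPolynomial.X 1 ^ 5 := ⟨_, rfl⟩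
  obtain ⟨gy, hgy⟩ : ∃ gy : MvPolynomial (Fin 3) k,
      gy = MvPolynomial.X 2 ^ 2 + MvPolynomial.X 1 * MvPolynomial.X 0 ^ 3 + MvPolynomial.X 1 ^ 3 := ⟨_, rfl⟩
  obtain ⟨⟨hfprime, hf0, hX0f⟩, ⟨hgxprime, hX0gx, hθx⟩, ⟨hgyprime, hX1gy, hθy⟩⟩ :=
    E8Forms.stub_e8Forms k f gx gy hf hgx hgy
  haveI := hfprime
  -- `R = k[X]/(f)` is a Noetherian domain of characteristic 5
  haveI : IsDomain (MvPolynomial (Fin 3) k ⧸ Ideal.span {f}) := Ideal.Quotient.isDomain _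
  haveI : CharP (MvPolynomial (Fin 3) k ⧸ Ideal.span {f}) 5 :=
    CharP.of_ringHom_of_ne_zero (algebraMap k (MvPolynomial (Fin 3) k ⧸ Ideal.span {f})) 5 (by decide)
  -- the centre: `𝔪 = (x̄₀, x̄₁, x̄₂) ≠ 0`
  obtain ⟨x, hx⟩ : ∃ x : Fin 3 → MvPolynomial (Fin 3) k ⧸ Ideal.span {f},
      x = fun j : Fin 3 => Ideal.Quotient.mk (Ideal.span {f}) (MvPolynomial.X j) := ⟨_, rfl⟩
  have hI : Ideal.span (Set.range x) ≠ ⊥ := by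
    intro hbot
    have hx0 : x 0 ∈ Ideal.span (Set.range x) := Ideal.subset_span (Set.mem_range_self 0)
    rw [hbot, Ideal.mem_bot, hx] at hx0
    exact hX0f (Ideal.Quotient.eq_zero_iff_mem.mp hx0)
  refine BlowupFiModel.blowupFiModel_of_maximal 5 x hI ?_ ?_
  · -- off the origin `R_P` is regular, hence satisfies the clause
    intro P _ hP
    have hP' : ¬ Ideal.span (Set.range fun j : Fin 3 =>
        Ideal.Quotient.mk (Ideal.span {f}) (MvPolynomial.X j)) ≤ P := by rwa [← hx]
    exact offCentre_fiClause k f hf P hP'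
  · -- on the exceptional divisor, chart by chart
    intro i _ Q hQ huQ
    have hi : i = 0 ∨ i = 1 ∨ i = 2 := by
      fin_cases i <;> simp
    rcases hi with rfl | rfl | rfl
    · -- the `x`-chart `k[X]/(gx)`: every exceptional closed point is regular
      have key := chart_clause_of_presentation k f hfprime hf0 x hx 0 gx 2 hgxprime hX0gx hθx
        (fun Q' _ hQ' => E8ChartXPoints.stub_e8ChartXPoints k gx hgx Q' hQ') Q huQ
      exact key
    · -- the `y`-chart `k[X]/(gy)`: regular except the `E₇` point, which passes Fedder's test
      have key := chart_clause_of_presentation k f hfprime hf0 x hx 1 gy 2 hgyprime hX1gy hθy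
        (fun Q' _ hQ' => E8ChartYPoints.stub_e8ChartYPoints k gy hgy Q' hQ') Q huQ
      exact key
    · -- the `z`-chart misses the exceptional divisor: `z̄/1` is a unit
      have hunit := E8ChartZUnit.stub_e8ChartZUnit k f hf x hx
      exact absurd (Ideal.eq_top_of_isUnit_mem Q huQ hunit) hQ.ne_top

/-- **The input is NOT its own model**: in characteristic `5` the surface `k[X]/(X₂² + X₀³ + X₁⁵)` violates the
clause at its local ring at the origin (`E8Char5.e8_origin_not_clause_char5`, Fedder's criterion, transported from
`k[X]_{(X)}/(f)` to `(k[X]/(f))_{(X̄)}` by `QuotLocalizationIso`) — so the model of `e8Char5FiModel` is produced by a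
genuine modification of a non-F-injective Cohen–Macaulay point. [cite: Fedder1983, Thm. 1.12] -/
theorem e8Char5_origin_not_clause (k : Type) [Field k] [CharP k 5] (f : MvPolynomial (Fin 3) k)
    (hf : f = MvPolynomial.X 2 ^ 2 + MvPolynomial.X 0 ^ 3 + MvPolynomial.X 1 ^ 5) :
    ∃ (P : Ideal (MvPolynomial (Fin 3) k ⧸ Ideal.span {f})) (_ : P.IsMaximal),
      ¬ (∀ d : ℕ, ringKrullDim (Localization.AtPrime P) = d → ∀ s : Fin d → Localization.AtPrime P,
        (Ideal.span (Set.range s)).radical.IsMaximal →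
          RingTheory.Sequence.IsWeaklyRegular (Localization.AtPrime P) (List.ofFn s) ∧
          ∀ y : Localization.AtPrime P, (∃ e : ℕ, y ^ 5 ^ e ∈ Ideal.span
            ((fun z : Localization.AtPrime P => z ^ 5 ^ e) ''
              (Ideal.span (Set.range s) : Set (Localization.AtPrime P)))) → y ∈ Ideal.span (Set.range s)) := by
  haveI hmax : (Ideal.span (Set.range (MvPolynomial.X : Fin 3 → MvPolynomial (Fin 3) k))).IsMaximal :=
    Fedder.isMaximal_span_range_X k 3
  obtain ⟨⟨hfm, -⟩, -⟩ := E8Char5.forms_mem_and_ne_zero k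
  rw [← hf] at hfm
  have hker : RingHom.ker (Ideal.Quotient.mk (Ideal.span {f})) ≤
      Ideal.span (Set.range (MvPolynomial.X : Fin 3 → MvPolynomial (Fin 3) k)) := by
    rw [Ideal.mk_ker, Ideal.span_singleton_le_iff_mem]
    exact hfm
  obtain ⟨hPmax, hcomap⟩ := BlowupFiModel.isMaximal_map_and_comap_map_of_surjective
    (Ideal.Quotient.mk (Ideal.span {f})) Ideal.Quotient.mk_surjective
    (Ideal.span (Set.range (MvPolynomial.X : Fin 3 → MvPolynomial (Fin 3) k))) hker
  haveI := hPmax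
  refine ⟨_, hPmax, fun hclause => ?_⟩
  obtain ⟨e⟩ := QuotLocalizationIso.stub_quotLocalizationIso (MvPolynomial (Fin 3) k) f
    (Ideal.span (Set.range (MvPolynomial.X : Fin 3 → MvPolynomial (Fin 3) k))) _ hcomap
  exact E8Char5.e8_origin_not_clause_char5 k _ rfl
    (hf ▸ DegreeZeroDescent.inlineClause_of_ringEquiv 5 e.symm hclause)

/-- **CALIBRATION, registered form** (lead stub `stub_e8Char5FiModel` of crux stmt-ResolutionOfSingularities-15315,
line `Sketch`): the point blow-up F-injectivizes `E₈⁰` in characteristic `5` — `= e8Char5FiModel`. [folklore] -/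
theorem stub_e8Char5FiModel : ∀ (k : Type) [Field k] [CharP k 5] (f : MvPolynomial (Fin 3) k),
    f = MvPolynomial.X 2 ^ 2 + MvPolynomial.X 0 ^ 3 + MvPolynomial.X 1 ^ 5 →
    ∃ (X' : Scheme.{0}) (π : X' ⟶ Spec (.of (MvPolynomial (Fin 3) k ⧸ Ideal.span {f}))), IsProper π ∧
      Literature.AlgebraicGeometry.Resolution.IsBirational π ∧
      ∀ y : X', IsDomain (X'.presheaf.stalk y) ∧ ∀ d : ℕ, ringKrullDim (X'.presheaf.stalk y) = d →
        ∀ s : Fin d → X'.presheaf.stalk y, (Ideal.span (Set.range s)).radical.IsMaximal →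
          RingTheory.Sequence.IsWeaklyRegular (X'.presheaf.stalk y) (List.ofFn s) ∧
          ∀ z : X'.presheaf.stalk y, (∃ e : ℕ, z ^ 5 ^ e ∈
              Ideal.span ((fun w : X'.presheaf.stalk y => w ^ 5 ^ e) ''
                (Ideal.span (Set.range s) : Set (X'.presheaf.stalk y)))) →
            z ∈ Ideal.span (Set.range s) :=
  fun k _ _ f hf => e8Char5FiModel k f hf

end Summit.ResolutionOfSingularities.ResolutionOfSingularities.Theorems.FInjectiveMacaulayfication.E8Char5FiModel

end
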